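import Literature.Probability.LatticeModels.TorusFourierProofs
import Literature.Analysis.Matrix.SchoenbergKernels
import HarnessLib

/-!
# Bochner's theorem on the finite torus `(ℤ/Lℤ)^d`, negative-type form

For a real EVEN function `f` on the discrete torus `(ℤ/Lℤ)^d` the translation-invariant kernel
`(x, y) ↦ -f (x - y)` is NEGATIVE DEFINITE in the sense of Berg–Christensen–Ressel
(`Literature.Analysis.Matrix.IsNegDefKernel`: `∑ c_j c_k ψ(x_j, x_k) ≤ 0` whenever `∑ c_j = 0`)
if and only if the Fourier coefficients of `f` at all NONZERO momenta are nonnegative,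
`0 ≤ ∑_x f(x) Re χ_k(x)` for `k ≠ 0` (`torusFourier_re_nonneg_iff_isNegDefKernel_neg_sub`).
Equivalently: `f` is, up to an additive constant, a nonnegative combination of the cosine
characters. This is the finite-group (discrete Lévy–Khintchine) form of Bochner's theorem:
the zero mode is free because the test vectors have zero sum.

* `isNegDefKernel_of_sum_le` — on a finite type it suffices to test functions `c : X → ℝ` with
  `∑ c = 0` (families with repetitions aggregate);
* `isNegDefKernel_neg_sub_of_torusFourier_re_nonneg` (⇐, via Fourier inversion and
  `sum_sum_mul_torusFourierInv_re`), `torusFourier_re_nonneg_of_isNegDefKernel_neg_sub` (⇒, test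
  vectors `Re χ_k`, `Im χ_k`), and the `iff`;
* `IsNegDefKernel.comp_fun` — pull-back of a negative definite kernel along any map (so the
  criterion applies to kernels `(x, y) ↦ -f (β x - β y)` factoring through a map `β` to the torus,
  e.g. block/coarse-graining maps).

Sources: C. Berg, J. P. R. Christensen, P. Ressel, *Harmonic Analysis on Semigroups* (1984),
Ch. 3 Def. 1.1 and Ch. 4 §3 (negative definite functions on abelian groups); W. Rudin, *Fourier
Analysis on Groups* (1962) §1.4.3 (Bochner); S. Friedli, Y. Velenik (2017) §10.4 (discrete torus
Fourier analysis, the tree's `torusFourier`). No definition is introduced.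
-/

noncomputable section

open Finset Complex
open scoped ComplexConjugate BigOperators

namespace Literature.Probability.LatticeModels

open Literature.Analysis.Matrix

/-! ### Negative definite kernels on finite types; pull-backs -/

/-- **Pull-back of a negative definite kernel**: if `ψ` is negative definite on `Y` and
`g : X → Y` is any map, then `(x, x') ↦ ψ (g x) (g x')` is negative definite on `X` (finite
families of `X` map to finite families of `Y`). [cite: BergChristensenRessel1984, Ch. 3 Def. 1.1 (PDF p. 68)] -/
theorem _root_.Literature.Analysis.Matrix.IsNegDefKernel.comp_fun {X Y : Type*} {ψ : Y → Y → ℝ}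
    (h : IsNegDefKernel ψ) (g : X → Y) : IsNegDefKernel fun x x' => ψ (g x) (g x') :=
  ⟨fun x y => h.1 (g x) (g y), fun n x c hc => h.2 n (g ∘ x) c hc⟩

/-- **Testing negative type on a finite type**: a symmetric kernel `ψ` on a finite type `X` is
negative definite as soon as `∑_{x,y} c_x c_y ψ(x,y) ≤ 0` for every FUNCTION `c : X → ℝ` with
`∑_x c_x = 0` — a finite family `x : Fin n → X` with coefficients `c` aggregates to the function
`a ↦ ∑_{j : x j = a} c_j`, with the same sum and the same quadratic form. [folklore] -/
theorem isNegDefKernel_of_sum_le {X : Type*} [Fintype X] [DecidableEq X] {ψ : X → X → ℝ}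
    (hsymm : ∀ x y, ψ x y = ψ y x)
    (h : ∀ c : X → ℝ, ∑ x, c x = 0 → ∑ x, ∑ y, c x * c y * ψ x y ≤ 0) :
    IsNegDefKernel ψ := by
  refine ⟨hsymm, fun n x c hc => ?_⟩
  -- aggregate the coefficients along the fibres of `x`
  set C : X → ℝ := fun a => ∑ j ∈ univ.filter (fun j => x j = a), c j with hC
  have hfib : ∀ (φ : X → ℝ), ∑ j, c j * φ (x j) = ∑ a, C a * φ a := fun φ => by
    simp only [hC, Finset.sum_mul]
    rw [← Finset.sum_fiberwise_of_maps_to (s := univ) (t := univ) (g := x) (fun j _ => mem_univ _)]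
    refine Finset.sum_congr rfl fun a _ => Finset.sum_congr rfl fun j hj => ?_
    rw [(Finset.mem_filter.1 hj).2]
  have hCsum : ∑ a, C a = 0 := by
    have := hfib fun _ => 1
    simp only [mul_one] at this
    rw [← this, hc]
  have hquad : ∑ j, ∑ k, c j * c k * ψ (x j) (x k) = ∑ a, ∑ b, C a * C b * ψ a b := by
    have h1 : ∀ j, ∑ k, c j * c k * ψ (x j) (x k) = c j * ∑ b, C b * ψ (x j) b := fun j => by
      have hf := hfib fun y => ψ (x j) y
      rw [← hf, Finset.mul_sum]
      exact Finset.sum_congr rfl fun k _ => by ring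
    simp_rw [h1]
    have hf2 := hfib fun a => ∑ b, C b * ψ a b
    rw [hf2]
    refine Finset.sum_congr rfl fun a _ => ?_
    rw [Finset.mul_sum]
    exact Finset.sum_congr rfl fun b _ => by ring
  rw [hquad]
  exact h C hCsum

/-- A negative definite kernel on a finite type has nonpositive quadratic form on every function
with zero sum (the converse bookkeeping of `isNegDefKernel_of_sum_le`, along `Fintype.equivFin`). [folklore] -/
theorem _root_.Literature.Analysis.Matrix.IsNegDefKernel.sum_le_of_fintype {X : Type*} [Fintype X]
    {ψ : X → X → ℝ}
    (h : IsNegDefKernel ψ) (c : X → ℝ) (hc : ∑ x, c x = 0) :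
    ∑ x, ∑ y, c x * c y * ψ x y ≤ 0 := by
  set e := (Fintype.equivFin X).symm with he
  have h2 := h.2 (Fintype.card X) e (c ∘ e) (by
    rw [show ∑ j, (c ∘ e) j = ∑ x, c x from e.sum_comp c, hc])
  calc ∑ x, ∑ y, c x * c y * ψ x y
      = ∑ j, ∑ y, c (e j) * c y * ψ (e j) y := (e.sum_comp fun x => ∑ y, c x * c y * ψ x y).symm
    _ = ∑ j, ∑ k, c (e j) * c (e k) * ψ (e j) (e k) :=
        Finset.sum_congr rfl fun j _ => (e.sum_comp fun y => c (e j) * c y * ψ (e j) y).symm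
    _ ≤ 0 := h2

/-! ### The finite torus -/

variable {d L : ℕ} [NeZero L]

/-- The Fourier coefficient of a real function at momentum `k`, real part:
`Re 𝓕f(k) = ∑_x f(x) Re χ_k(x)` (the kernel of `torusFourier` is `conj χ_k`, whose real part is
`Re χ_k`). [folklore] -/
theorem torusFourier_ofReal_re_eq (f : TorusSite d L → ℝ) (k : TorusSite d L) :
    (torusFourier (fun x => (f x : ℂ)) k).re = ∑ x, f x * (torusChar k x).re := by
  rw [torusFourier_eq_sum_torusChar, Complex.re_sum]
  refine Finset.sum_congr rfl fun x _ => ?_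
  rw [Complex.re_ofReal_mul, Complex.conj_re]

/-- **Bochner on the finite torus, negative-type form (⇐).** Let `f : (ℤ/Lℤ)^d → ℝ` be even. If
the Fourier coefficients of `f` at all nonzero momenta are nonnegative,
`0 ≤ ∑_x f(x) Re χ_k(x)` for `k ≠ 0`, then `(x, y) ↦ -f(x - y)` is a negative definite kernel:
by Fourier inversion `∑_{x,y} c_x c_y f(x-y) = L^{-d} ∑_k Re 𝓕f(k) ‖𝓕c(k)‖²`, and the `k = 0`
term vanishes when `∑ c = 0`. (Berg–Christensen–Ressel 1984, Ch. 4 §3; Rudin 1962 §1.4.3 —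
discrete Lévy–Khintchine / Bochner on a finite abelian group.) [folklore] -/
theorem isNegDefKernel_neg_sub_of_torusFourier_re_nonneg (f : TorusSite d L → ℝ)
    (heven : ∀ x, f (-x) = f x)
    (hpos : ∀ k : TorusSite d L, k ≠ 0 → 0 ≤ ∑ x, f x * (torusChar k x).re) :
    IsNegDefKernel fun x y : TorusSite d L => -f (x - y) := by
  classical
  refine isNegDefKernel_of_sum_le (fun x y => by rw [← heven (x - y), neg_sub]) fun c hc => ?_
  -- Fourier inversion: `f = 𝓕⁻¹ (𝓕 f)`
  set g : TorusSite d L → ℂ := torusFourier (fun x => (f x : ℂ)) with hg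
  have hinv : ∀ z, f z = (torusFourierInv g z).re := fun z => by
    have := congrFun (torusFourier_inversion_holds (d := d) (L := L) (fun x => (f x : ℂ))) z
    rw [hg, this, Complex.ofReal_re]
  have hquad : ∑ x, ∑ y, c x * c y * -f (x - y) =
      -(((L : ℝ) ^ d)⁻¹ * ∑ k, (g k).re * ‖torusFourier (fun x => (c x : ℂ)) k‖ ^ 2) := by
    rw [← sum_sum_mul_torusFourierInv_re g c]
    simp only [mul_neg, Finset.sum_neg_distrib, hinv]
  rw [hquad, neg_nonpos]
  refine mul_nonneg (by positivity) (Finset.sum_nonneg fun k _ => ?_)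
  by_cases hk : k = 0
  · -- the zero mode: `𝓕c(0) = ∑ c = 0`
    subst hk
    have : torusFourier (fun x => (c x : ℂ)) 0 = 0 := by
      rw [torusFourier_apply_zero, ← Complex.ofReal_sum, hc, Complex.ofReal_zero]
    rw [this, norm_zero]
    simp
  · rw [hg, torusFourier_ofReal_re_eq]
    exact mul_nonneg (hpos k hk) (by positivity)

/-- **Bochner on the finite torus, negative-type form (⇒).** If `(x, y) ↦ -f(x - y)` is a negative
definite kernel on `(ℤ/Lℤ)^d`, then `0 ≤ ∑_x f(x) Re χ_k(x)` for every `k ≠ 0`: the real test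
vectors `Re χ_k` and `Im χ_k` have zero sum (orthogonality of characters, `k ≠ 0`), and the sum of
their two quadratic forms is `Re ∑_{x,y} χ_k(x) conj χ_k(y) f(x-y) = L^d ∑_z f(z) Re χ_k(z)`.
(Berg–Christensen–Ressel 1984, Ch. 4 §3; Rudin 1962 §1.4.3.) [folklore] -/
theorem torusFourier_re_nonneg_of_isNegDefKernel_neg_sub (f : TorusSite d L → ℝ)
    (h : IsNegDefKernel fun x y : TorusSite d L => -f (x - y))
    (k : TorusSite d L) (hk : k ≠ 0) : 0 ≤ ∑ x, f x * (torusChar k x).re := by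
  classical
  -- the two real test vectors
  have hzero : ∑ x, torusChar k x = 0 := by rw [sum_torusChar_right, if_neg hk]
  have hre : ∑ x, (torusChar k x).re = 0 := by rw [← Complex.re_sum, hzero, Complex.zero_re]
  have him : ∑ x, (torusChar k x).im = 0 := by rw [← Complex.im_sum, hzero, Complex.zero_im]
  have h1 := h.sum_le_of_fintype (fun x => (torusChar k x).re) hre
  have h2 := h.sum_le_of_fintype (fun x => (torusChar k x).im) him
  -- their sum is `-(∑_{x,y} Re(χ_k(x) conj χ_k(y)) f(x-y)) = -(L^d ∑_z f z Re χ_k z)`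
  have hsum : ∑ x, ∑ y, (torusChar k x).re * (torusChar k y).re * -f (x - y) +
      ∑ x, ∑ y, (torusChar k x).im * (torusChar k y).im * -f (x - y) =
      -∑ x, ∑ y, f (x - y) * (torusChar k (x - y)).re := by
    rw [← Finset.sum_add_distrib, ← Finset.sum_neg_distrib]
    refine Finset.sum_congr rfl fun x _ => ?_
    rw [← Finset.sum_add_distrib, ← Finset.sum_neg_distrib]
    refine Finset.sum_congr rfl fun y _ => ?_
    rw [torusChar_sub_right, Complex.mul_re, Complex.conj_re, Complex.conj_im]
    ring
  have hshift : ∑ x, ∑ y, f (x - y) * (torusChar k (x - y)).re =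
      (Fintype.card (TorusSite d L) : ℝ) * ∑ z, f z * (torusChar k z).re := by
    rw [Finset.sum_comm]
    have : ∀ y : TorusSite d L, ∑ x, f (x - y) * (torusChar k (x - y)).re =
        ∑ z, f z * (torusChar k z).re := fun y =>
      Equiv.sum_comp (Equiv.subRight y) fun z => f z * (torusChar k z).re
    simp_rw [this]
    rw [Finset.sum_const, Finset.card_univ, nsmul_eq_mul]
  have hle : ∑ x, ∑ y, (torusChar k x).re * (torusChar k y).re * -f (x - y) +
      ∑ x, ∑ y, (torusChar k x).im * (torusChar k y).im * -f (x - y) ≤ 0 := add_nonpos h1 h2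
  rw [hsum, hshift, neg_nonpos] at hle
  have hcard : (0 : ℝ) < (Fintype.card (TorusSite d L) : ℝ) := by
    exact_mod_cast Fintype.card_pos
  exact nonneg_of_mul_nonneg_right hle hcard

/-- **Bochner on the finite torus, negative-type form.** For an even real `f` on `(ℤ/Lℤ)^d`:
`(x, y) ↦ -f(x - y)` is negative definite iff `0 ≤ ∑_x f(x) Re χ_k(x)` for all `k ≠ 0`.
(Berg–Christensen–Ressel 1984, Ch. 4 §3; Rudin 1962 §1.4.3.) [folklore] -/
theorem isNegDefKernel_neg_sub_iff_torusFourier_re_nonneg (f : TorusSite d L → ℝ)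
    (heven : ∀ x, f (-x) = f x) :
    IsNegDefKernel (fun x y : TorusSite d L => -f (x - y)) ↔
      ∀ k : TorusSite d L, k ≠ 0 → 0 ≤ ∑ x, f x * (torusChar k x).re :=
  ⟨fun h k hk => torusFourier_re_nonneg_of_isNegDefKernel_neg_sub f h k hk,
    isNegDefKernel_neg_sub_of_torusFourier_re_nonneg f heven⟩

/-- **Pulled-back form** (the shape used for block / coarse-grained kernels): if a kernel `K` on any
type `X` factors as `K x y = f (β x - β y)` through a map `β : X → (ℤ/Lℤ)^d` with `f` even and
`0 ≤ ∑_x f(x) Re χ_k(x)` for all `k ≠ 0`, then `(x, y) ↦ -K x y` is negative definite. [folklore] -/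
theorem isNegDefKernel_neg_of_factor_torus {X : Type*} (K : X → X → ℝ) (β : X → TorusSite d L)
    (f : TorusSite d L → ℝ) (hK : ∀ x y, K x y = f (β x - β y)) (heven : ∀ x, f (-x) = f x)
    (hpos : ∀ k : TorusSite d L, k ≠ 0 → 0 ≤ ∑ x, f x * (torusChar k x).re) :
    IsNegDefKernel fun x y : X => -K x y := by
  have h := (isNegDefKernel_neg_sub_of_torusFourier_re_nonneg f heven hpos).comp_fun β
  refine ⟨fun x y => ?_, fun n x c hc => ?_⟩
  · simp only [hK, ← heven (β x - β y), neg_sub]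
  · have := h.2 n x c hc
    simpa only [hK] using this

/-! ### Appended 2026-08-17 (prover, crux `LevyTransport` stmt-HubbardSuperconductivity-15049, input (c)):
the Lévy mass is bounded by the axis means of the negative-type function

For a NONNEGATIVE spectral density `ν` on `(ℤ/Lℤ)^d` with no zero mode (`ν 0 = 0`) — the Lévy
coefficients of an infinitely divisible translation-invariant kernel, by the criterion above — the
associated negative-type function `φ(X) = Σ_k ν_k (1 - Re χ_k(X))` controls the total mass
`|ν| = Σ_k ν_k` through its MEANS ALONG THE COORDINATE AXES alone:
`|ν| ≤ Σ_i L⁻¹ Σ_{j ∈ ℤ/Lℤ} φ(j e_i)`, because the axis mean of `Re χ_k(j e_i)` is the indicator of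
`k_i = 0`, and a nonzero `k` has a nonzero coordinate. (Discrete Lévy–Khintchine bookkeeping: only the
two axis means of `φ` enter the Lévy mass of a planar kernel — the axes being where reflection
positivity speaks.) Berg–Christensen–Ressel (1984) Ch. 4 §3; folklore. -/

/-- The character at an axis point: `χ_k(j e_i) = e(k_i j)`. [folklore] -/
theorem torusChar_axisPoint (k : TorusSite d L) (i : Fin d) (j : ZMod L) :
    torusChar k (Pi.single i j) = ZMod.stdAddChar (k i * j) := by
  classical
  unfold torusChar
  rw [Finset.prod_eq_single i]
  · rw [Pi.single_eq_same]
  · intro l _ hl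
    rw [Pi.single_eq_of_ne hl, mul_zero, AddChar.map_zero_eq_one]
  · intro h
    exact absurd (Finset.mem_univ i) h

/-- **Axis orthogonality**: `Σ_{j ∈ ℤ/Lℤ} χ_k(j e_i) = L · [k_i = 0]`. [folklore] -/
theorem sum_torusChar_axisPoint (k : TorusSite d L) (i : Fin d) :
    ∑ j : ZMod L, torusChar k (Pi.single i j) = if k i = 0 then (L : ℂ) else 0 := by
  classical
  simp_rw [torusChar_axisPoint, mul_comm (k i)]
  rw [AddChar.sum_mulShift (k i) (ZMod.isPrimitive_stdAddChar L), ZMod.card, Nat.cast_ite, Nat.cast_zero]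

/-- **The axis mean of `1 - Re χ_k` is the indicator of `k_i ≠ 0`**:
`L⁻¹ Σ_j (1 - Re χ_k(j e_i)) = [k_i ≠ 0]`. [folklore] -/
theorem axisMean_one_sub_torusChar_re (k : TorusSite d L) (i : Fin d) :
    (∑ j : ZMod L, (1 - (torusChar k (Pi.single i j)).re)) / (L : ℝ) = if k i = 0 then 0 else 1 := by
  classical
  have hL : (L : ℝ) ≠ 0 := Nat.cast_ne_zero.2 (NeZero.ne L)
  rw [Finset.sum_sub_distrib, Finset.sum_const, Finset.card_univ, ZMod.card, nsmul_eq_mul, mul_one,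
    ← Complex.re_sum, sum_torusChar_axisPoint]
  split_ifs with h
  · simp
  · rw [Complex.zero_re, sub_zero, div_self hL]

/-- **The Lévy mass is bounded by the axis means of the negative-type function.** For `ν ≥ 0` on
`(ℤ/Lℤ)^d` with `ν 0 = 0` and `φ(X) = Σ_k ν_k (1 - Re χ_k(X))`:
`Σ_k ν_k ≤ Σ_i L⁻¹ Σ_{j} φ(j e_i)` — the right-hand side equals `Σ_k ν_k · #{i : k_i ≠ 0}` and every
`k ≠ 0` has a nonzero coordinate. [cite: BergChristensenRessel1984, Ch. 4 §3] -/
theorem levyMass_le_sum_axisMean (ν : TorusSite d L → ℝ) (hν : ∀ k, 0 ≤ ν k) (hν0 : ν 0 = 0) :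
    ∑ k : TorusSite d L, ν k ≤
      ∑ i : Fin d, (∑ j : ZMod L, ∑ k : TorusSite d L, ν k * (1 - (torusChar k (Pi.single i j)).re)) / (L : ℝ) := by
  classical
  -- the right-hand side, mode by mode
  have hrhs : ∑ i : Fin d, (∑ j : ZMod L, ∑ k : TorusSite d L,
      ν k * (1 - (torusChar k (Pi.single i j)).re)) / (L : ℝ) =
      ∑ k : TorusSite d L, ν k * ∑ i : Fin d, (if k i = 0 then (0 : ℝ) else 1) := by
    have hswap : ∀ i : Fin d, (∑ j : ZMod L, ∑ k : TorusSite d L,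
        ν k * (1 - (torusChar k (Pi.single i j)).re)) / (L : ℝ) =
        ∑ k : TorusSite d L, ν k * (if k i = 0 then (0 : ℝ) else 1) := by
      intro i
      rw [Finset.sum_comm, Finset.sum_div]
      refine Finset.sum_congr rfl fun k _ => ?_
      rw [← Finset.mul_sum, mul_div_assoc, axisMean_one_sub_torusChar_re]
    rw [Finset.sum_congr rfl fun i _ => hswap i, Finset.sum_comm]
    refine Finset.sum_congr rfl fun k _ => ?_
    rw [Finset.mul_sum]
  rw [hrhs]
  refine Finset.sum_le_sum fun k _ => ?_
  by_cases hk : k = 0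
  · subst hk
    rw [hν0, zero_mul]
  · -- a nonzero `k` has a nonzero coordinate, so the weight is at least `1`
    obtain ⟨i, hi⟩ : ∃ i, k i ≠ 0 := by
      by_contra h
      push Not at h
      exact hk (funext h)
    have hw : (1 : ℝ) ≤ ∑ l : Fin d, (if k l = 0 then (0 : ℝ) else 1) :=
      calc (1 : ℝ) = (if k i = 0 then (0 : ℝ) else 1) := (if_neg hi).symm
        _ ≤ ∑ l : Fin d, (if k l = 0 then (0 : ℝ) else 1) :=
          Finset.single_le_sum (f := fun l => if k l = 0 then (0 : ℝ) else 1)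
            (fun l _ => by split_ifs <;> norm_num) (Finset.mem_univ i)
    nlinarith [hν k]

end Literature.Probability.LatticeModels

end
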